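import Summits.CriticalPhenomena.SAWScalingLimit.Theorems.SAWLoopFugacityFlowIsingBoundaryRatioWindowExtResistanceCells
import Summits.CriticalPhenomena.SAWScalingLimit.Theorems.SAWLoopFugacityFlowIsingBoundaryRatioWindowExtResistanceBlock
import HarnessLib

/-!
# Resistance bound for the window rectangle — extraction of a boundary vertex along a connected set
(line `fk-anchor-transfer`, crux `IsingBoundaryRatio`, stmt-CriticalPhenomena-10650; third helper module of the
proof of `WindowExtResistanceBound`, `…IsingBoundaryRatioWindowResistanceDefs.lean`)

`wer_extraction`: the combinatorial heart of the elementary direction of Chelkak 2016, Prop. 6.2 (i)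
("for any curve `γ` … it is easy to construct a nearest-neighbour lattice path `γ^δ` running along `γ`"),
in the form needed for a discrete topological rectangle `E ⊆ E(Ω_δ)` carved out of the mesh graph of a
Jordan domain `D` that is only RELATIVELY closed (hypothesis `hclosed`: an `Ω_δ`-edge from a vertex of `E`
satisfying `Good` to a site satisfying `Win` is in `E`) and whose boundary is detected abstractly
(`DiscreteRect.bdVerts`). Data: a preconnected bounded set `Γ ⊆ ℂ` (a piece of a chart semicircle) such
that lattice sites of `Ω_δ` within `3δ` of `Γ` are `Good` and `Win` (`hnear`), points of `Γ` satisfying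
`Deep` have all lattice edges within `2δ` present in `Ω_δ` (`hdeep`), a start point `z₀ ∈ Γ`, deep, in a
closed cell `Q₀` whose four corners are vertices of `E`, and an end point `z₁ ∈ Γ` within `δ/8` of a
frontier point of `D`. Conclusion: a boundary vertex `u` of `E` joined to the lower-left corner of `Q₀` by
a walk of `⟨E⟩` all of whose vertices are within `4δ` of `Γ`, with `u` either within `4δ` of `z₁` or within
`2δ` of a NON-deep point of `Γ`.

Proof. Let `𝒬` be the finite set of closed cells meeting `Γ`, `Full q` = "four corners in `verts E`, four
sides in `E`", and call `q ∈ 𝒬` good if it is full and reachable from `Q₀` through a chain of full cells of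
`𝒬`, consecutive ones sharing a corner. (A) If every cell of `𝒬` is good, the cell of `z₁` is, and the
end-cell lemma `wer_end_cell` (`…WindowExtResistanceBlock.lean`: otherwise the `3 × 3` block around it has
its outer boundary in `closure D` and could not contain the nearby frontier point) gives a boundary vertex at
a corner or one present edge away; the chain lemma `wer_chain_walk` (`…WindowExtResistanceCells.lean`) gives
the walk. (B) Otherwise the unions of the good and of the other cells of `𝒬` are closed sets covering the
preconnected `Γ`, both meeting it, so some point `z ∈ Γ` lies in a good cell `A` and another cell `B`; they
share a corner `v ∈ verts E`, and walking around `B` from `v` (`wer_walkaround`; at a vertex of `E` near `Γ`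
a side is in `E` by `hclosed` unless it is not an `Ω_δ`-edge, which makes the vertex a boundary vertex)
either makes `B` full — then good, a contradiction — or reaches a boundary vertex `u` of `E` at a corner of
`B`, within `2δ` of `z`; and `z` is not deep, for otherwise all four lattice edges at `u` would be
`Ω_δ`-edges towards window sites, hence in `E`.
-/

noncomputable section

open scoped Classical Topology
open Filter Set Metric SimpleGraph
open Literature.Probability.LatticeModels Literature.Probability.RandomPlanarGeometry
open Literature.Probability.Percolation (BondConfig)
open UpperHalfPlane (upperHalfPlaneSet)

namespace Summit.CriticalPhenomena.SAWScalingLimit.Theorems.IsingBoundaryRatio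

/-- **Extraction of a boundary vertex of `E` along a connected set `Γ`** (the face chain of Chelkak 2016,
Prop. 6.2 (i), elementary direction; see the module docstring for the statement and the proof). [folklore] -/
theorem wer_extraction (D : JordanDomain) {δ : ℝ} (hδ : 0 < δ) {E : Finset (Sym2 (Site 2))}
    (hE : ∀ e ∈ E, e ∈ (discreteDomainGraph D.carrier δ).edgeSet)
    {Good Win : Site 2 → Prop} {Deep : ℂ → Prop}
    (hclosed : ∀ x y : Site 2, x ∈ DiscreteRect.verts E → Good x → Win y →
      (discreteDomainGraph D.carrier δ).Adj x y → s(x, y) ∈ E)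
    {Γ : Set ℂ} (hΓc : IsPreconnected Γ) (hΓb : Bornology.IsBounded Γ)
    (hnear : ∀ x : Site 2, x ∈ meshDomain D.carrier δ → infDist (meshPoint δ x) Γ ≤ 3 * δ → Good x ∧ Win x)
    (hdeep : ∀ z ∈ Γ, Deep z → ∀ x : Site 2, dist (meshPoint δ x) z ≤ 2 * δ →
      ∀ k : Fin 4, (discreteDomainGraph D.carrier δ).Adj x (x + DiscreteRect.dir k))
    {k₀ j₀ : ℤ} {z₀ : ℂ} (hz₀ : z₀ ∈ Γ) (hz₀c : z₀ ∈ closure (Mesh.cell δ k₀ j₀)) (hz₀d : Deep z₀)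
    (hQ₀ : ∀ a b, Mesh.corner k₀ j₀ a b ∈ DiscreteRect.verts E)
    {z₁ p : ℂ} (hz₁ : z₁ ∈ Γ) (hp : p ∈ frontier D.carrier) (hpz : dist p z₁ < δ / 8) :
    ∃ u ∈ DiscreteRect.bdVerts E,
      (∃ w : (fromEdgeSet (↑E : Set (Sym2 (Site 2)))).Walk (Mesh.corner k₀ j₀ false false) u,
        ∀ x ∈ w.support, infDist (meshPoint δ x) Γ ≤ 4 * δ) ∧
      (dist (meshPoint δ u) z₁ ≤ 4 * δ ∨ ∃ z' ∈ Γ, ¬ Deep z' ∧ dist (meshPoint δ u) z' ≤ 2 * δ) := by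
  set Ω := discreteDomainGraph D.carrier δ with hΩ
  set G := fromEdgeSet (↑E : Set (Sym2 (Site 2))) with hG
  have hΓne : Γ.Nonempty := ⟨z₀, hz₀⟩
  -- distances of corners and neighbours to `Γ`
  have hinfc : ∀ {k j : ℤ} {z : ℂ}, z ∈ Γ → z ∈ closure (Mesh.cell δ k j) → ∀ a b,
      infDist (meshPoint δ (Mesh.corner k j a b)) Γ ≤ 2 * δ :=
    fun hz hzc a b => (infDist_le_dist_of_mem hz).trans (wer_dist_corner_le hδ hzc a b)
  have hinfd : ∀ (x : Site 2) (kk : Fin 4), infDist (meshPoint δ (x + DiscreteRect.dir kk)) Γ ≤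
      infDist (meshPoint δ x) Γ + δ := fun x kk =>
    (infDist_le_infDist_add_dist).trans (by rw [wer_dist_add_dir hδ])
  -- the closing alternative at a vertex of `E` near `Γ`
  have hHC : ∀ (x : Site 2) (kk : Fin 4), x ∈ DiscreteRect.verts E → infDist (meshPoint δ x) Γ ≤ 2 * δ →
      s(x, x + DiscreteRect.dir kk) ∈ E ∨ x ∈ DiscreteRect.bdVerts E := by
    intro x kk hxv hxd
    by_cases hadj : Ω.Adj x (x + DiscreteRect.dir kk)
    · left
      have hxD := wer_verts_subset hE hxv
      have hyD : x + DiscreteRect.dir kk ∈ meshDomain D.carrier δ := (discreteDomainGraph_adj_iff.1 hadj).2.2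
      exact hclosed x _ hxv (hnear x hxD (by linarith)).1
        (hnear _ hyD ((hinfd x kk).trans (by linarith))).2 hadj
    · right
      exact ⟨kk, hxv, fun hmem => hadj (hE _ hmem)⟩
  -- all four edges at a vertex of `E` next to a deep point of `Γ` are in `E`
  have hdeepE : ∀ {z : ℂ}, z ∈ Γ → Deep z → ∀ x : Site 2, x ∈ DiscreteRect.verts E →
      dist (meshPoint δ x) z ≤ 2 * δ → ∀ kk : Fin 4, s(x, x + DiscreteRect.dir kk) ∈ E := by
    intro z hz hzd x hxv hxz kk
    have hadj := hdeep z hz hzd x hxz kk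
    have hxD := wer_verts_subset hE hxv
    have hyD : x + DiscreteRect.dir kk ∈ meshDomain D.carrier δ := (discreteDomainGraph_adj_iff.1 hadj).2.2
    have hxd : infDist (meshPoint δ x) Γ ≤ 2 * δ := (infDist_le_dist_of_mem hz).trans hxz
    exact hclosed x _ hxv (hnear x hxD (by linarith)).1 (hnear _ hyD ((hinfd x kk).trans (by linarith))).2 hadj
  -- the finite set of cells meeting `Γ`
  obtain ⟨R, hR⟩ := hΓb.subset_closedBall 0
  set N : ℤ := ⌈R / δ⌉ + 2 with hN
  set 𝒬 : Finset (ℤ × ℤ) := ((Finset.Icc (-N) N) ×ˢ (Finset.Icc (-N) N)).filter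
    (fun q => (closure (Mesh.cell δ q.1 q.2) ∩ Γ).Nonempty) with h𝒬
  have hmemQ : ∀ q : ℤ × ℤ, (closure (Mesh.cell δ q.1 q.2) ∩ Γ).Nonempty → q ∈ 𝒬 := by
    rintro ⟨k, j⟩ ⟨z, hzc, hzΓ⟩
    refine Finset.mem_filter.2 ⟨?_, z, hzc, hzΓ⟩
    have hzR : ‖z‖ ≤ R := by simpa using hR hzΓ
    have hre := (Complex.abs_re_le_norm z).trans hzR
    have him := (Complex.abs_im_le_norm z).trans hzR
    rw [abs_le] at hre him
    rw [Mesh.closure_cell hδ, Complex.mem_reProdIm] at hzc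
    obtain ⟨⟨h1, h2⟩, h3, h4⟩ := hzc
    have hRδ : R / δ ≤ ⌈R / δ⌉ := Int.le_ceil _
    have hk1 : (k : ℝ) ≤ R / δ := by rw [le_div_iff₀ hδ]; linarith
    have hk2 : -(R / δ) - 1 ≤ (k : ℝ) := by
      have h' : -R / δ ≤ (k : ℝ) + 1 := by rw [div_le_iff₀ hδ]; linarith
      rw [neg_div] at h'; linarith
    have hj1 : (j : ℝ) ≤ R / δ := by rw [le_div_iff₀ hδ]; linarith
    have hj2 : -(R / δ) - 1 ≤ (j : ℝ) := by
      have h' : -R / δ ≤ (j : ℝ) + 1 := by rw [div_le_iff₀ hδ]; linarith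
      rw [neg_div] at h'; linarith
    have e1 : (k : ℝ) ≤ (N : ℝ) := by rw [hN]; push_cast; linarith
    have e2 : (-N : ℝ) ≤ (k : ℝ) := by rw [hN]; push_cast; linarith
    have e3 : (j : ℝ) ≤ (N : ℝ) := by rw [hN]; push_cast; linarith
    have e4 : (-N : ℝ) ≤ (j : ℝ) := by rw [hN]; push_cast; linarith
    simp only [Finset.mem_product, Finset.mem_Icc]
    exact ⟨⟨by exact_mod_cast e2, by exact_mod_cast e1⟩, by exact_mod_cast e4, by exact_mod_cast e3⟩
  have hQmeet : ∀ q ∈ 𝒬, (closure (Mesh.cell δ q.1 q.2) ∩ Γ).Nonempty := fun q hq =>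
    (Finset.mem_filter.1 hq).2
  -- full cells and the reachability relation
  set FullE : ℤ × ℤ → Prop := fun q =>
    (∀ a b, Mesh.corner q.1 q.2 a b ∈ DiscreteRect.verts E) ∧
      (∀ b, s(Mesh.corner q.1 q.2 false b, Mesh.corner q.1 q.2 true b) ∈ E) ∧
      (∀ a, s(Mesh.corner q.1 q.2 a false, Mesh.corner q.1 q.2 a true) ∈ E) with hFullE
  set Rel : ℤ × ℤ → ℤ × ℤ → Prop := fun A B =>
    A ∈ 𝒬 ∧ B ∈ 𝒬 ∧ FullE A ∧ FullE B ∧ |A.1 - B.1| ≤ 1 ∧ |A.2 - B.2| ≤ 1 with hRel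
  set P : Site 2 → Prop := fun x => infDist (meshPoint δ x) Γ ≤ 4 * δ with hP
  have hPcorner : ∀ q ∈ 𝒬, ∀ a b, P (Mesh.corner q.1 q.2 a b) := by
    intro q hq a b
    obtain ⟨z, hzc, hzΓ⟩ := hQmeet q hq
    exact (hinfc hzΓ hzc a b).trans (by linarith)
  have hRel' : ∀ A B, Rel A B →
      ((∀ b, s(Mesh.corner B.1 B.2 false b, Mesh.corner B.1 B.2 true b) ∈ E) ∧
        (∀ a, s(Mesh.corner B.1 B.2 a false, Mesh.corner B.1 B.2 a true) ∈ E)) ∧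
      |A.1 - B.1| ≤ 1 ∧ |A.2 - B.2| ≤ 1 ∧ ∀ a b, P (Mesh.corner B.1 B.2 a b) :=
    fun A B h => ⟨h.2.2.2.1.2, h.2.2.2.2.1, h.2.2.2.2.2, hPcorner B h.2.1⟩
  -- the start cell is full
  have hq₀ : ((k₀, j₀) : ℤ × ℤ) ∈ 𝒬 := hmemQ (k₀, j₀) ⟨z₀, hz₀c, hz₀⟩
  have hside : ∀ {k j : ℤ} {z : ℂ}, z ∈ Γ → z ∈ closure (Mesh.cell δ k j) → Deep z →
      (∀ a b, Mesh.corner k j a b ∈ DiscreteRect.verts E) →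
      (∀ b, s(Mesh.corner k j false b, Mesh.corner k j true b) ∈ E) ∧
        (∀ a, s(Mesh.corner k j a false, Mesh.corner k j a true) ∈ E) := by
    intro k j z hz hzc hzd hv
    constructor
    · intro b
      have := hdeepE hz hzd _ (hv false b) (wer_dist_corner_le hδ hzc false b) 0
      rwa [← show Mesh.corner k j (!false) b = Mesh.corner k j false b + DiscreteRect.dir 0 from
        wer_corner_not_fst k j false b] at this
    · intro a
      have := hdeepE hz hzd _ (hv a false) (wer_dist_corner_le hδ hzc a false) 1
      rwa [← show Mesh.corner k j a (!false) = Mesh.corner k j a false + DiscreteRect.dir 1 from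
        wer_corner_not_snd k j a false] at this
  have hFull₀ : FullE (k₀, j₀) := ⟨hQ₀, hside hz₀ hz₀c hz₀d hQ₀⟩
  have h0 : ((∀ b, s(Mesh.corner k₀ j₀ false b, Mesh.corner k₀ j₀ true b) ∈ E) ∧
      (∀ a, s(Mesh.corner k₀ j₀ a false, Mesh.corner k₀ j₀ a true) ∈ E)) ∧
      ∀ a b, P (Mesh.corner k₀ j₀ a b) := ⟨hFull₀.2, hPcorner (k₀, j₀) hq₀⟩
  -- HC in the form of the walk-around lemma, for cells of `𝒬`
  have hHC1 : ∀ q ∈ 𝒬, ∀ a b, Mesh.corner q.1 q.2 a b ∈ DiscreteRect.verts E →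
      s(Mesh.corner q.1 q.2 a b, Mesh.corner q.1 q.2 (!a) b) ∈ E ∨
        Mesh.corner q.1 q.2 a b ∈ DiscreteRect.bdVerts E := by
    intro q hq a b hv
    obtain ⟨z, hzc, hzΓ⟩ := hQmeet q hq
    rw [wer_corner_not_fst]
    exact hHC _ _ hv (hinfc hzΓ hzc a b)
  have hHC2 : ∀ q ∈ 𝒬, ∀ a b, Mesh.corner q.1 q.2 a b ∈ DiscreteRect.verts E →
      s(Mesh.corner q.1 q.2 a b, Mesh.corner q.1 q.2 a (!b)) ∈ E ∨
        Mesh.corner q.1 q.2 a b ∈ DiscreteRect.bdVerts E := by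
    intro q hq a b hv
    obtain ⟨z, hzc, hzΓ⟩ := hQmeet q hq
    rw [wer_corner_not_snd]
    exact hHC _ _ hv (hinfc hzΓ hzc a b)
  by_cases hall : ∀ q ∈ 𝒬, FullE q ∧ Relation.ReflTransGen Rel (k₀, j₀) q
  · -- Case A: every cell meeting `Γ` is full and reachable; look at the end cell
    set qb : ℤ × ℤ := (⌊z₁.re / δ⌋, ⌊z₁.im / δ⌋) with hqb
    have hz₁c : z₁ ∈ closure (Mesh.cell δ qb.1 qb.2) := wer_mem_closure_cell_floor hδ z₁
    have hqbQ : qb ∈ 𝒬 := hmemQ qb ⟨z₁, hz₁c, hz₁⟩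
    obtain ⟨hFb, hchain⟩ := hall qb hqbQ
    obtain ⟨u, hubd, hu⟩ := wer_end_cell D hδ hE hFb.1 hz₁c hp hpz
    refine ⟨u, hubd, ?_⟩
    rcases hu with ⟨a, b, rfl⟩ | ⟨a, b, k', rfl, hmem⟩
    · obtain ⟨w, hw⟩ := wer_chain_walk hRel' h0 hchain a b
      exact ⟨⟨w, hw⟩, Or.inl ((wer_dist_corner_le hδ hz₁c a b).trans (by linarith))⟩
    · obtain ⟨w, hw⟩ := wer_chain_walk hRel' h0 hchain a b
      have hadj : G.Adj (Mesh.corner qb.1 qb.2 a b) (Mesh.corner qb.1 qb.2 a b + DiscreteRect.dir k') :=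
        (fromEdgeSet_adj _).2 ⟨hmem, (wer_adj_add_dir _ k').ne⟩
      refine ⟨⟨w.concat hadj, fun x hx => ?_⟩, Or.inl ?_⟩
      · rw [Walk.support_concat, List.mem_append, List.mem_singleton] at hx
        rcases hx with hx | rfl
        · exact hw x hx
        · exact (hinfd _ k').trans (by linarith [hinfc hz₁ hz₁c a b])
      · calc dist (meshPoint δ (Mesh.corner qb.1 qb.2 a b + DiscreteRect.dir k')) z₁
            ≤ dist (meshPoint δ (Mesh.corner qb.1 qb.2 a b + DiscreteRect.dir k'))
                (meshPoint δ (Mesh.corner qb.1 qb.2 a b)) + dist (meshPoint δ (Mesh.corner qb.1 qb.2 a b)) z₁ :=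
              dist_triangle _ _ _
          _ ≤ δ + 2 * δ := by rw [wer_dist_add_dir hδ]; exact add_le_add le_rfl (wer_dist_corner_le hδ hz₁c a b)
          _ ≤ 4 * δ := by linarith
  · -- Case B: a boundary pair of cells
    push Not at hall
    obtain ⟨qx, hqxQ, hqx⟩ := hall
    set good : Finset (ℤ × ℤ) := 𝒬.filter (fun q => FullE q ∧ Relation.ReflTransGen Rel (k₀, j₀) q) with hgood
    set bad : Finset (ℤ × ℤ) := 𝒬.filter (fun q => ¬ (FullE q ∧ Relation.ReflTransGen Rel (k₀, j₀) q)) with hbad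
    set T : Set ℂ := ⋃ q ∈ good, closure (Mesh.cell δ q.1 q.2) with hT
    set T' : Set ℂ := ⋃ q ∈ bad, closure (Mesh.cell δ q.1 q.2) with hT'
    have hTc : IsClosed T := isClosed_biUnion_finset fun q _ => isClosed_closure
    have hT'c : IsClosed T' := isClosed_biUnion_finset fun q _ => isClosed_closure
    have hcover : Γ ⊆ T ∪ T' := by
      intro z hz
      set qz : ℤ × ℤ := (⌊z.re / δ⌋, ⌊z.im / δ⌋) with hqz
      have hzc : z ∈ closure (Mesh.cell δ qz.1 qz.2) := wer_mem_closure_cell_floor hδ z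
      have hqzQ : qz ∈ 𝒬 := hmemQ qz ⟨z, hzc, hz⟩
      by_cases hgz : FullE qz ∧ Relation.ReflTransGen Rel (k₀, j₀) qz
      · left
        rw [hT, Set.mem_iUnion₂]
        exact ⟨qz, Finset.mem_filter.2 ⟨hqzQ, hgz⟩, hzc⟩
      · right
        rw [hT', Set.mem_iUnion₂]
        exact ⟨qz, Finset.mem_filter.2 ⟨hqzQ, hgz⟩, hzc⟩
    have hne : (Γ ∩ T).Nonempty := by
      refine ⟨z₀, hz₀, ?_⟩
      rw [hT, Set.mem_iUnion₂]
      exact ⟨(k₀, j₀), Finset.mem_filter.2 ⟨hq₀, hFull₀, Relation.ReflTransGen.refl⟩, hz₀c⟩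
    have hne' : (Γ ∩ T').Nonempty := by
      obtain ⟨z, hzc, hzΓ⟩ := hQmeet qx hqxQ
      refine ⟨z, hzΓ, ?_⟩
      rw [hT', Set.mem_iUnion₂]
      exact ⟨qx, Finset.mem_filter.2 ⟨hqxQ, fun h => hqx h.1 h.2⟩, hzc⟩
    obtain ⟨z, hzΓ, hzT, hzT'⟩ := isPreconnected_closed_iff.1 hΓc T T' hTc hT'c hcover hne hne'
    rw [hT, Set.mem_iUnion₂] at hzT
    rw [hT', Set.mem_iUnion₂] at hzT'
    obtain ⟨A, hA, hzA⟩ := hzT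
    obtain ⟨B, hB, hzB⟩ := hzT'
    obtain ⟨hAQ, hFA, hchainA⟩ := Finset.mem_filter.1 hA
    obtain ⟨hBQ, hBbad⟩ := Finset.mem_filter.1 hB
    obtain ⟨hk, hj⟩ := wer_near_of_mem_closure_cell hδ hzA hzB
    have hcc := wer_common_corner hk hj
    -- the common corner is a vertex of `E`; walk around `B`
    have hvB : Mesh.corner B.1 B.2 (decide (B.1 < A.1)) (decide (B.2 < A.2)) ∈ DiscreteRect.verts E := by
      rw [← hcc]; exact hFA.1 _ _
    rcases wer_walkaround hvB (hHC1 B hBQ) (hHC2 B hBQ) with hFB | ⟨a, b, -, hubd, w2, hw2⟩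
    · exfalso
      refine hBbad ⟨hFB, hchainA.tail ⟨hAQ, hBQ, hFA, hFB, hk, hj⟩⟩
    · obtain ⟨w1, hw1⟩ := wer_chain_walk hRel' h0 hchainA (decide (A.1 < B.1)) (decide (A.2 < B.2))
      refine ⟨_, hubd, ⟨(w1.copy rfl hcc).append w2, fun x hx => ?_⟩, Or.inr ⟨z, hzΓ, fun hzd => ?_,
        wer_dist_corner_le hδ hzB a b⟩⟩
      · rw [Walk.mem_support_append_iff, Walk.support_copy] at hx
        rcases hx with hx | hx
        · exact hw1 x hx
        · obtain ⟨a'', b'', rfl⟩ := hw2 x hx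
          exact hPcorner B hBQ a'' b''
      · obtain ⟨kk, hv, hnot⟩ := hubd
        exact hnot (hdeepE hzΓ hzd _ hv (wer_dist_corner_le hδ hzB a b) kk)


/-- `wer_extraction`, closed form (registered sub-goal of stmt-CriticalPhenomena-10650). [folklore] -/
theorem wer_extraction' : ∀ (D : JordanDomain) {δ : ℝ}, 0 < δ → ∀ {E : Finset (Sym2 (Site 2))}, (∀ e ∈ E, e ∈ (discreteDomainGraph D.carrier δ).edgeSet) → ∀ {Good Win : Site 2 → Prop} {Deep : ℂ → Prop}, (∀ x y : Site 2, x ∈ DiscreteRect.verts E → Good x → Win y → (discreteDomainGraph D.carrier δ).Adj x y → s(x, y) ∈ E) → ∀ {Γ : Set ℂ}, IsPreconnected Γ → Bornology.IsBounded Γ → (∀ x : Site 2, x ∈ meshDomain D.carrier δ → infDist (meshPoint δ x) Γ ≤ 3 * δ → Good x ∧ Win x) → (∀ z ∈ Γ, Deep z → ∀ x : Site 2, dist (meshPoint δ x) z ≤ 2 * δ → ∀ k : Fin 4, (discreteDomainGraph D.carrier δ).Adj x (x + DiscreteRect.dir k)) → ∀ {k₀ j₀ : ℤ} {z₀ : ℂ},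 z₀ ∈ Γ → z₀ ∈ closure (Mesh.cell δ k₀ j₀) → Deep z₀ → (∀ a b, Mesh.corner k₀ j₀ a b ∈ DiscreteRect.verts E) → ∀ {z₁ p : ℂ}, z₁ ∈ Γ → p ∈ frontier D.carrier → dist p z₁ < δ / 8 → ∃ u ∈ DiscreteRect.bdVerts E, (∃ w : (fromEdgeSet (↑E : Set (Sym2 (Site 2)))).Walk (Mesh.corner k₀ j₀ false false) u, ∀ x ∈ w.support, infDist (meshPoint δ x) Γ ≤ 4 * δ) ∧ (dist (meshPoint δ u) z₁ ≤ 4 * δ ∨ ∃ z' ∈ Γ, ¬ Deep z' ∧ dist (meshPoint δ u) z' ≤ 2 * δ) :=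
  fun D _ hδ _ hE _ _ _ hclosed _ hΓc hΓb hnear hdeep _ _ _ hz₀ hz₀c hz₀d hQ₀ _ _ hz₁ hp hpz =>
    wer_extraction D hδ hE hclosed hΓc hΓb hnear hdeep hz₀ hz₀c hz₀d hQ₀ hz₁ hp hpz

end Summit.CriticalPhenomena.SAWScalingLimit.Theorems.IsingBoundaryRatio

end
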